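import Mathlib
import HarnessLib
import Literature.MathematicalPhysics.QuantumFieldTheory.MassGapFromLatticeClustering
import Literature.MathematicalPhysics.QuantumLattice.SchwingerGrowthTwoFactor
import Summits.QuantumFields.YangMills.Theorems.ConvexGribovBodyContinuumLegGivenGapStubCltOfCscl
import Summits.QuantumFields.YangMills.Theorems.ParabolicTrajectoryContinuumLimitOnTrajectoryStubArp
import Summits.QuantumFields.YangMills.Theorems.ParabolicTrajectoryContinuumLimitOnTrajectorySlabRP
import Summits.QuantumFields.YangMills.Theorems.ParabolicTrajectoryContinuumLimitOnTrajectoryUvbOfUuvb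
import Summits.QuantumFields.YangMills.Theorems.ParabolicTrajectoryContinuumLimitOnTrajectoryUclRot

/-!
# `ContinuumLegGivenGap` (stmt-QuantumFields-15828), line `Sketch` (reshape 15): kinematics for `stub_uclOfCscl` — part A

Support file for the crux item stmt-QuantumFields-15828 (registered glue stub `stub_uclOfCscl` of line `Sketch`,
reshape 15: k-uniform rate-free SPATIAL clustering (route ParabolicTrajectory's `UCL r sch`) from time-direction
Cauchy–Schwarz clustering (CSCL), asymptotic proper-rotation invariance (ROT), the uniform-threshold bounds (UUVB),
polynomial volume growth and `β_k → ∞`). This part collects the kinematics that do not involve the rotation: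

* `arp_pair` — (ARP) on the two-element OS family `(Φ, μ • Ψ)` of possibly different arities (the family is indexed
  through a sigma type, as in `OSReconstructionNoE1.osForm_self_nonneg`): the Gram-type quadratic
  `𝓓(ΘΦ*⊗Φ) + μ 𝓓(ΘΦ*⊗Ψ) + μ̄ 𝓓(ΘΨ*⊗Φ) + |μ|² 𝓓(ΘΨ*⊗Ψ)` is eventually almost real-non-negative;
* `cs_pair` — the **asymptotic Cauchy–Schwarz inequality** `‖𝓓(ΘΦ* ⊗ T_v Ψ)‖ ≤ √(K|ΘΦ*⊗Φ|) √(K|ΘΨ*⊗Ψ| + η) + η`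
  eventually in `k`, for time-ordered `Φ, Ψ`, SPATIAL `v` and a k-uniform E0′ bound `K` — uniform in `v` (the landed
  `stub_asympCS` fed by `arp_pair`, the spatial translate moved off the norm by the translation half of E1);
* `trunc_pair_le` — the resulting `v`-uniform bound of the truncated pairing `𝓓(ΘΦ*⊗T_vΨ) − 𝓓(ΘΦ*)𝓓(Ψ)`;
* degenerate arities `ucl_zero_left`, `ucl_zero_right` for a general translation vector (cf. `clt_zero_left/right`).
[folklore]
-/

noncomputable section

namespace Summit.QuantumFields.YangMills.Theorems.ContinuumLegGivenGap

open scoped SchwartzMap ComplexConjugate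
open Filter Topology MeasureTheory
open Literature.MathematicalPhysics.QuantumFieldTheory Literature.MathematicalPhysics.QuantumLattice
  Literature.MathematicalPhysics.AQFT Literature.Probability.LatticeModels
open Summit.QuantumFields.YangMills.Cruxes.ContinuumLimitOnTrajectory.TwoOrbitSynchronisation
  (curvDistribution curvCLM curvCLM_apply curvDistribution_sub curvDistribution_zero curvDistribution_smul
   curvDistribution_add UUVB UVB ARP AsympTransl PolyVolumeGrowth PlaqIdx stub_transl)
open Summit.QuantumFields.YangMills.Cruxes.LatticeGapOnTrajectory.OrbitKantorovichFiniteSize.Transfer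
  (eq_appendTensor_of_isAppendTensorOf)

section Helpers

variable {G : Type} [Group G] [TopologicalSpace G] [IsTopologicalGroup G] [CompactSpace G]
  [MeasurableSpace G] [BorelSpace G] (r : LatticeRep G) (sch : SpeciesScheme (YMSpecies G))

/-! ## §1 Small kinematic identities -/

omit [TopologicalSpace G] [IsTopologicalGroup G] [CompactSpace G] [MeasurableSpace G] [BorelSpace G] [Group G] in
/-- The OS adjoint commutes with a SPATIAL translation: `Θ(T_v Ψ)* = T_v (ΘΨ*)` for `v⁰ = 0`
(`θ v = v`). [folklore] -/
theorem osAdjoint_translateMulti_spatial {m : ℕ} {v : EuclideanSpace ℝ (Fin 4)} (hv : v 0 = 0) (Ψ : 𝓢((Fin m → EuclideanSpace ℝ (Fin 4)), ℂ)) :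
    osAdjoint (translateMulti v Ψ) = translateMulti v (osAdjoint Ψ) := by
  ext x
  simp only [osAdjoint_apply, translateMulti_apply, map_sub,
    OSReconstructionNoE1.timeReflection_of_apply_zero (d := 4) hv]

omit [TopologicalSpace G] [IsTopologicalGroup G] [CompactSpace G] [MeasurableSpace G] [BorelSpace G] [Group G] in
/-- For a spatial `v`, the reflected self-pairing tensor of the translate is the translate of the reflected
self-pairing tensor: `Θ(T_vΨ)* ⊗ T_vΨ = T_v (ΘΨ* ⊗ Ψ)`. [folklore] -/
theorem osAdjoint_appendTensor_translateMulti_spatial {m : ℕ} {v : EuclideanSpace ℝ (Fin 4)} (hv : v 0 = 0)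
    (Ψ : 𝓢((Fin m → EuclideanSpace ℝ (Fin 4)), ℂ)) :
    (osAdjoint (translateMulti v Ψ)).appendTensor (translateMulti v Ψ) =
      translateMulti v ((osAdjoint Ψ).appendTensor Ψ) := by
  rw [osAdjoint_translateMulti_spatial hv]
  ext x
  simp [translateMulti_apply, SchwartzMap.appendTensor_apply, Function.comp_def]

omit [TopologicalSpace G] [IsTopologicalGroup G] [CompactSpace G] [MeasurableSpace G] [BorelSpace G] [Group G] in
/-- A spatial translate of a time-ordered test function is time-ordered. [folklore] -/
theorem isTimeOrdered_translateMulti_spatial {m : ℕ} {v : EuclideanSpace ℝ (Fin 4)} (hv : v 0 = 0) {Ψ : 𝓢((Fin m → EuclideanSpace ℝ (Fin 4)), ℂ)}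
    (hΨ : IsTimeOrdered Ψ) : IsTimeOrdered (translateMulti v Ψ) :=
  OSReconstructionNoE1.isTimeOrdered_translateMulti hΨ (le_of_eq hv.symm)

/-! ## §2 (ARP) on a two-element family of different arities -/

/-- **(ARP) on the OS pair `(Φ, μ • Ψ)`**: for time-ordered `Φ` (arity `n`) and `Ψ` (arity `m`) and any coefficient `μ`,
eventually in `k` the Gram-type quadratic `𝓓(ΘΦ*⊗Φ) + μ 𝓓(ΘΦ*⊗Ψ) + μ̄ 𝓓(ΘΨ*⊗Φ) + μ̄μ 𝓓(ΘΨ*⊗Ψ)` has real part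
`≥ −ε` and imaginary part `≤ ε` in modulus (route ParabolicTrajectory's `ARP` with `N = 2`, the family indexed through
the sigma type `Σ p, 𝓢(((ℝ⁴)ᵖ), ℂ)` so that the two arities coexist). [folklore] -/
theorem arp_pair (hARP : ARP r sch) {n m : ℕ} {Φ : 𝓢((Fin n → EuclideanSpace ℝ (Fin 4)), ℂ)} {Ψ : 𝓢((Fin m → EuclideanSpace ℝ (Fin 4)), ℂ)}
    (hΦ : IsTimeOrdered Φ) (hΨ : IsTimeOrdered Ψ) (μ : ℂ) {ε : ℝ} (hε : 0 < ε) :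
    ∀ᶠ k in atTop,
      -ε ≤ (curvDistribution r sch k (n + n) ((osAdjoint Φ).appendTensor Φ) +
          μ * curvDistribution r sch k (n + m) ((osAdjoint Φ).appendTensor Ψ) +
          conj μ * curvDistribution r sch k (m + n) ((osAdjoint Ψ).appendTensor Φ) +
          conj μ * μ * curvDistribution r sch k (m + m) ((osAdjoint Ψ).appendTensor Ψ)).re ∧
      |(curvDistribution r sch k (n + n) ((osAdjoint Φ).appendTensor Φ) +
          μ * curvDistribution r sch k (n + m) ((osAdjoint Φ).appendTensor Ψ) +
          conj μ * curvDistribution r sch k (m + n) ((osAdjoint Ψ).appendTensor Φ) +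
          conj μ * μ * curvDistribution r sch k (m + m) ((osAdjoint Ψ).appendTensor Ψ)).im| ≤ ε := by
  -- the two-element family, indexed through a sigma type
  let fam : Fin 2 → (Σ p : ℕ, 𝓢((Fin p → EuclideanSpace ℝ (Fin 4)), ℂ)) := Fin.cons ⟨n, Φ⟩ fun _ => ⟨m, μ • Ψ⟩
  let deg : Fin 2 → ℕ := fun j => (fam j).1
  let F : (j : Fin 2) → 𝓢((Fin (deg j) → EuclideanSpace ℝ (Fin 4)), ℂ) := fun j => (fam j).2
  have hF : ∀ j, IsTimeOrdered (F j) := by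
    intro j
    refine Fin.cases ?_ (fun j => ?_) j
    · exact hΦ
    · exact OSReconstructionNoE1.isTimeOrdered_smul μ hΨ
  let H : (i j : Fin 2) → 𝓢((Fin (deg i + deg j) → EuclideanSpace ℝ (Fin 4)), ℂ) := fun i j => (osAdjoint (F i)).appendTensor (F j)
  have h := hARP 2 deg F hF H (fun i j => isAppendTensorOf_appendTensor _ _) ε hε
  have hsum : ∀ k, ∑ i, ∑ j, curvDistribution r sch k (deg i + deg j) (H i j) =
      curvDistribution r sch k (n + n) ((osAdjoint Φ).appendTensor Φ) +
        μ * curvDistribution r sch k (n + m) ((osAdjoint Φ).appendTensor Ψ) +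
        conj μ * curvDistribution r sch k (m + n) ((osAdjoint Ψ).appendTensor Φ) +
        conj μ * μ * curvDistribution r sch k (m + m) ((osAdjoint Ψ).appendTensor Ψ) := by
    intro k
    rw [Fin.sum_univ_two, Fin.sum_univ_two, Fin.sum_univ_two]
    change curvDistribution r sch k (n + n) ((osAdjoint Φ).appendTensor Φ) +
        curvDistribution r sch k (n + m) ((osAdjoint Φ).appendTensor (μ • Ψ)) +
        (curvDistribution r sch k (m + n) ((osAdjoint (μ • Ψ)).appendTensor Φ) +
          curvDistribution r sch k (m + m) ((osAdjoint (μ • Ψ)).appendTensor (μ • Ψ))) = _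
    simp only [osAdjoint_smul, SchwartzMap.appendTensor_smul_left, SchwartzMap.appendTensor_smul_right,
      curvDistribution_smul]
    ring
  filter_upwards [h] with k hk
  rw [hsum k] at hk
  exact hk

/-! ## §3 The asymptotic Cauchy–Schwarz inequality for OS pairs with a spatially translated partner -/

/-- **Asymptotic Cauchy–Schwarz for an OS pair with a spatially translated partner.** Let `K p ≥ 0` be a k-uniform
E0′ bound on `⁰𝒮` beyond one threshold, (ARP) and the translation half of E1 hold. For time-ordered `Φ` (arity `n`),
`Ψ` (arity `m`), a SPATIAL vector `v` and `η > 0`, EVENTUALLY in `k`: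
`‖𝓓_{n+m}(ΘΦ* ⊗ T_vΨ)‖ ≤ √(K₂ₙ |ΘΦ*⊗Φ|) · √(K₂ₘ |ΘΨ*⊗Ψ| + η) + η` — a bound that does not depend on `v`
(the abstract asymptotic Cauchy–Schwarz statement `hA` — the landed `stub_asympCS`, a HYPOTHESIS here as in the
registered assembly stub — with `A = 𝓓(ΘΦ*⊗Φ)`, `B = 𝓓(ΘΦ*⊗T_vΨ)`, `B' = 𝓓(Θ(T_vΨ)*⊗Φ)`, `D = 𝓓(Θ(T_vΨ)*⊗T_vΨ) = 𝓓(T_v(ΘΨ*⊗Ψ))`,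
the latter within `η` of `𝓓(ΘΨ*⊗Ψ)` by asymptotic translation invariance). [folklore] -/
theorem cs_pair
    (hA : ∀ (A B B' D : ℕ → ℂ),
      (∃ C : ℝ, ∀ᶠ k in atTop, ‖A k‖ ≤ C ∧ ‖B k‖ ≤ C ∧ ‖B' k‖ ≤ C ∧ ‖D k‖ ≤ C) →
      (∀ (μ : ℂ) (ε : ℝ), 0 < ε → ∀ᶠ k in atTop,
        -ε ≤ (A k + μ * B k + (starRingEnd ℂ) μ * B' k + (starRingEnd ℂ) μ * μ * D k).re ∧
          |(A k + μ * B k + (starRingEnd ℂ) μ * B' k + (starRingEnd ℂ) μ * μ * D k).im| ≤ ε) →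
      ∀ η : ℝ, 0 < η → ∀ᶠ k in atTop, ‖B k‖ ≤ Real.sqrt ‖A k‖ * Real.sqrt ‖D k‖ + η)
    (hARP : ARP r sch) (hTr : AsympTransl r sch) {K : ℕ → ℝ} {s : ℕ}
    (hb : ∀ᶠ k in atTop, ∀ (p : ℕ) (F : 𝓢((Fin p → EuclideanSpace ℝ (Fin 4)), ℂ)), IsOffDiagonal F →
      ‖curvDistribution r sch k p F‖ ≤ K p * schwartzNorm (p * s) F)
    {n m : ℕ} {Φ : 𝓢((Fin n → EuclideanSpace ℝ (Fin 4)), ℂ)} {Ψ : 𝓢((Fin m → EuclideanSpace ℝ (Fin 4)), ℂ)} (hΦ : IsTimeOrdered Φ) (hΨ : IsTimeOrdered Ψ)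
    {v : EuclideanSpace ℝ (Fin 4)} (hv : v 0 = 0) {η : ℝ} (hη : 0 < η) :
    ∀ᶠ k in atTop,
      ‖curvDistribution r sch k (n + m) ((osAdjoint Φ).appendTensor (translateMulti v Ψ))‖ ≤
        Real.sqrt (K (n + n) * schwartzNorm ((n + n) * s) ((osAdjoint Φ).appendTensor Φ)) *
          Real.sqrt (K (m + m) * schwartzNorm ((m + m) * s) ((osAdjoint Ψ).appendTensor Ψ) + η) + η := by
  set Ψ' := translateMulti v Ψ with hΨ'
  have hΨ't : IsTimeOrdered Ψ' := isTimeOrdered_translateMulti_spatial hv hΨ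
  -- the four sequences
  set A : ℕ → ℂ := fun k => curvDistribution r sch k (n + n) ((osAdjoint Φ).appendTensor Φ)
  set B : ℕ → ℂ := fun k => curvDistribution r sch k (n + m) ((osAdjoint Φ).appendTensor Ψ')
  set B' : ℕ → ℂ := fun k => curvDistribution r sch k (m + n) ((osAdjoint Ψ').appendTensor Φ)
  set D : ℕ → ℂ := fun k => curvDistribution r sch k (m + m) ((osAdjoint Ψ').appendTensor Ψ')
  -- off-diagonality of the four tensors
  have hoA : IsOffDiagonal ((osAdjoint Φ).appendTensor Φ) := OSReconstructionNoE1.isOffDiagonal_appendTensor_osAdjoint hΦ hΦ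
  have hoB : IsOffDiagonal ((osAdjoint Φ).appendTensor Ψ') :=
    OSReconstructionNoE1.isOffDiagonal_appendTensor_osAdjoint hΦ hΨ't
  have hoB' : IsOffDiagonal ((osAdjoint Ψ').appendTensor Φ) :=
    OSReconstructionNoE1.isOffDiagonal_appendTensor_osAdjoint hΨ't hΦ
  have hoD : IsOffDiagonal ((osAdjoint Ψ').appendTensor Ψ') :=
    OSReconstructionNoE1.isOffDiagonal_appendTensor_osAdjoint hΨ't hΨ't
  have hoD₀ : IsOffDiagonal ((osAdjoint Ψ).appendTensor Ψ) := OSReconstructionNoE1.isOffDiagonal_appendTensor_osAdjoint hΨ hΨ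
  -- hypothesis 1 of the abstract lemma: eventual boundedness
  set C : ℝ := max (max (K (n + n) * schwartzNorm ((n + n) * s) ((osAdjoint Φ).appendTensor Φ))
      (K (n + m) * schwartzNorm ((n + m) * s) ((osAdjoint Φ).appendTensor Ψ')))
    (max (K (m + n) * schwartzNorm ((m + n) * s) ((osAdjoint Ψ').appendTensor Φ))
      (K (m + m) * schwartzNorm ((m + m) * s) ((osAdjoint Ψ').appendTensor Ψ')))
  have h1 : ∃ C : ℝ, ∀ᶠ k in atTop, ‖A k‖ ≤ C ∧ ‖B k‖ ≤ C ∧ ‖B' k‖ ≤ C ∧ ‖D k‖ ≤ C := by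
    refine ⟨C, hb.mono fun k hk => ⟨?_, ?_, ?_, ?_⟩⟩
    · exact (hk _ _ hoA).trans ((le_max_left _ _).trans (le_max_left _ _))
    · exact (hk _ _ hoB).trans ((le_max_right _ _).trans (le_max_left _ _))
    · exact (hk _ _ hoB').trans ((le_max_left _ _).trans (le_max_right _ _))
    · exact (hk _ _ hoD).trans ((le_max_right _ _).trans (le_max_right _ _))
  -- hypothesis 2: (ARP) on the pair `(Φ, μ • Ψ')`
  have h2 : ∀ (μ : ℂ) (ε : ℝ), 0 < ε → ∀ᶠ k in atTop,
      -ε ≤ (A k + μ * B k + (starRingEnd ℂ) μ * B' k + (starRingEnd ℂ) μ * μ * D k).re ∧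
        |(A k + μ * B k + (starRingEnd ℂ) μ * B' k + (starRingEnd ℂ) μ * μ * D k).im| ≤ ε :=
    fun μ ε hε => arp_pair r sch hARP hΦ hΨ't μ hε
  have hη2 : 0 < η / 2 := by positivity
  -- the translate moved off the norm: `D k` is within `η` of `𝓓(ΘΨ*⊗Ψ)` eventually
  have hD : ∀ᶠ k in atTop, ‖D k‖ ≤ K (m + m) * schwartzNorm ((m + m) * s) ((osAdjoint Ψ).appendTensor Ψ) + η := by
    have ht := hTr (m + m) ((osAdjoint Ψ).appendTensor Ψ) hoD₀ v
    have ht' : ∀ᶠ k in atTop, ‖curvDistribution r sch k (m + m) (translateMulti v ((osAdjoint Ψ).appendTensor Ψ)) -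
        curvDistribution r sch k (m + m) ((osAdjoint Ψ).appendTensor Ψ)‖ ≤ η := by
      have := ht.norm
      rw [norm_zero] at this
      exact (this.eventually (ge_mem_nhds hη)).mono fun k hk => hk
    filter_upwards [hb, ht'] with k hk hk'
    have hDk : D k = curvDistribution r sch k (m + m) (translateMulti v ((osAdjoint Ψ).appendTensor Ψ)) := by
      simp only [D, hΨ', osAdjoint_appendTensor_translateMulti_spatial hv]
    rw [hDk]
    calc ‖curvDistribution r sch k (m + m) (translateMulti v ((osAdjoint Ψ).appendTensor Ψ))‖
        ≤ ‖curvDistribution r sch k (m + m) ((osAdjoint Ψ).appendTensor Ψ)‖ +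
          ‖curvDistribution r sch k (m + m) (translateMulti v ((osAdjoint Ψ).appendTensor Ψ)) -
            curvDistribution r sch k (m + m) ((osAdjoint Ψ).appendTensor Ψ)‖ := norm_le_insert' _ _
      _ ≤ K (m + m) * schwartzNorm ((m + m) * s) ((osAdjoint Ψ).appendTensor Ψ) + η :=
          add_le_add (hk _ _ hoD₀) hk'
  -- the abstract lemma, and the bounds on `A k`, `D k`
  filter_upwards [hA A B B' D h1 h2 (η / 2) hη2, hb, hD] with k hk hkb hkD
  have hAk : ‖A k‖ ≤ K (n + n) * schwartzNorm ((n + n) * s) ((osAdjoint Φ).appendTensor Φ) := hkb _ _ hoA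
  calc ‖B k‖ ≤ Real.sqrt ‖A k‖ * Real.sqrt ‖D k‖ + η / 2 := hk
    _ ≤ Real.sqrt (K (n + n) * schwartzNorm ((n + n) * s) ((osAdjoint Φ).appendTensor Φ)) *
          Real.sqrt (K (m + m) * schwartzNorm ((m + m) * s) ((osAdjoint Ψ).appendTensor Ψ) + η) + η := by
        gcongr
        linarith

/-- **The `v`-uniform bound on the truncated pairing.** Under the hypotheses of `cs_pair`, for time-ordered `Φ, Ψ`,
a spatial `v` and `η > 0`, EVENTUALLY in `k`:
`‖𝓓_{n+m}(ΘΦ* ⊗ T_vΨ) − 𝓓ₙ(ΘΦ*) 𝓓ₘ(Ψ)‖ ≤ √(K₂ₙ|ΘΦ*⊗Φ|)·√(K₂ₘ|ΘΨ*⊗Ψ| + η) + η + Kₙ|ΘΦ*| · Kₘ|Ψ|`. [folklore] -/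
theorem trunc_pair_le
    (hA : ∀ (A B B' D : ℕ → ℂ),
      (∃ C : ℝ, ∀ᶠ k in atTop, ‖A k‖ ≤ C ∧ ‖B k‖ ≤ C ∧ ‖B' k‖ ≤ C ∧ ‖D k‖ ≤ C) →
      (∀ (μ : ℂ) (ε : ℝ), 0 < ε → ∀ᶠ k in atTop,
        -ε ≤ (A k + μ * B k + (starRingEnd ℂ) μ * B' k + (starRingEnd ℂ) μ * μ * D k).re ∧
          |(A k + μ * B k + (starRingEnd ℂ) μ * B' k + (starRingEnd ℂ) μ * μ * D k).im| ≤ ε) →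
      ∀ η : ℝ, 0 < η → ∀ᶠ k in atTop, ‖B k‖ ≤ Real.sqrt ‖A k‖ * Real.sqrt ‖D k‖ + η)
    (hARP : ARP r sch) (hTr : AsympTransl r sch) {K : ℕ → ℝ} {s : ℕ}
    (hK : ∀ p, 0 ≤ K p)
    (hb : ∀ᶠ k in atTop, ∀ (p : ℕ) (F : 𝓢((Fin p → EuclideanSpace ℝ (Fin 4)), ℂ)), IsOffDiagonal F →
      ‖curvDistribution r sch k p F‖ ≤ K p * schwartzNorm (p * s) F)
    {n m : ℕ} {Φ : 𝓢((Fin n → EuclideanSpace ℝ (Fin 4)), ℂ)} {Ψ : 𝓢((Fin m → EuclideanSpace ℝ (Fin 4)), ℂ)} (hΦ : IsTimeOrdered Φ) (hΨ : IsTimeOrdered Ψ)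
    {v : EuclideanSpace ℝ (Fin 4)} (hv : v 0 = 0) {η : ℝ} (hη : 0 < η) :
    ∀ᶠ k in atTop,
      ‖curvDistribution r sch k (n + m) ((osAdjoint Φ).appendTensor (translateMulti v Ψ)) -
          curvDistribution r sch k n (osAdjoint Φ) * curvDistribution r sch k m Ψ‖ ≤
        Real.sqrt (K (n + n) * schwartzNorm ((n + n) * s) ((osAdjoint Φ).appendTensor Φ)) *
            Real.sqrt (K (m + m) * schwartzNorm ((m + m) * s) ((osAdjoint Ψ).appendTensor Ψ) + η) + η +
          K n * schwartzNorm (n * s) (osAdjoint Φ) * (K m * schwartzNorm (m * s) Ψ) := by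
  filter_upwards [cs_pair r sch hA hARP hTr hb hΦ hΨ hv hη, hb] with k hk hkb
  refine (norm_sub_le _ _).trans (add_le_add hk ?_)
  rw [norm_mul]
  exact mul_le_mul (hkb _ _ hΦ.isOffDiagonal.osAdjoint) (hkb _ _ hΨ.isOffDiagonal) (norm_nonneg _)
    (mul_nonneg (hK _) (schwartzNorm_nonneg _ _))

/-! ## §4 Degenerate arities, general translation vector -/

/-- **Arity `n = 0`**: the truncated quantity is `(ΘF*)(pt) · (𝓓ₘ(T_v G') − 𝓓ₘ(G'))` (`curvDistribution_reindex`,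
`curvDistribution_zero`), eventually below any `c > 0` by the translation half of E1. [folklore] -/
theorem ucl_zero_left (hTr : AsympTransl r sch) {m : ℕ} (F : 𝓢((Fin 0 → EuclideanSpace ℝ (Fin 4)), ℂ)) {G' : 𝓢((Fin m → EuclideanSpace ℝ (Fin 4)), ℂ)}
    (hG : IsOffDiagonal G') (v : EuclideanSpace ℝ (Fin 4)) {c : ℝ} (hc : 0 < c) :
    ∀ᶠ k in atTop,
      ‖curvDistribution r sch k (0 + m) ((osAdjoint F).appendTensor (translateMulti v G')) -
        curvDistribution r sch k 0 (osAdjoint F) * curvDistribution r sch k m G'‖ ≤ c := by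
  have hx : ∀ x : Fin (0 + m) → EuclideanSpace ℝ (Fin 4),
      ((osAdjoint F).appendTensor (translateMulti v G')) x = osAdjoint F default *
        (translateMulti v G') (fun j => x (finCongr (Nat.zero_add m).symm j)) := by
    intro x
    rw [SchwartzMap.appendTensor_apply]
    congr 1
    · exact congrArg _ (Subsingleton.elim _ _)
    · exact congrArg _ (funext fun j => congrArg x (Fin.ext (by simp)))
  have h2 := (tendsto_const_nhds (x := ‖osAdjoint F default‖)).mul (hTr m G' hG v).norm
  rw [norm_zero, mul_zero] at h2
  filter_upwards [h2.eventually_lt_const hc] with k hk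
  rw [curvDistribution_reindex r sch k (finCongr (Nat.zero_add m).symm) _ _ _ hx, curvDistribution_zero, ← mul_sub,
    norm_mul]
  exact hk.le

/-- **Arity `m = 0`**: the truncated quantity vanishes identically. [folklore] -/
theorem ucl_zero_right (k : ℕ) {n : ℕ} (F : 𝓢((Fin n → EuclideanSpace ℝ (Fin 4)), ℂ)) (G' : 𝓢((Fin 0 → EuclideanSpace ℝ (Fin 4)), ℂ)) (v : EuclideanSpace ℝ (Fin 4)) :
    curvDistribution r sch k (n + 0) ((osAdjoint F).appendTensor (translateMulti v G')) -
      curvDistribution r sch k n (osAdjoint F) * curvDistribution r sch k 0 G' = 0 := by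
  have hx : ∀ x : Fin (n + 0) → EuclideanSpace ℝ (Fin 4),
      ((osAdjoint F).appendTensor (translateMulti v G')) x =
        (translateMulti v G') default * osAdjoint F (fun j => x (finCongr (Nat.add_zero n).symm j)) := by
    intro x
    rw [SchwartzMap.appendTensor_apply, mul_comm]
    congr 1
    exact congrArg _ (Subsingleton.elim _ _)
  rw [curvDistribution_reindex r sch k (finCongr (Nat.add_zero n).symm) _ _ _ hx, curvDistribution_zero,
    translateMulti_of_isEmpty, mul_comm, sub_self]

end Helpers

/-! ## §5 The registered sub-goal of part A -/

/-- `stub_uclOfCsclPartA` — **part A of `stub_uclOfCscl` (registered sub-goal of stmt-QuantumFields-15828, line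
`Sketch`, reshape 15)**: the `v`-UNIFORM bound on the truncated OS pairing with a spatially translated partner, from the
abstract asymptotic Cauchy–Schwarz statement (landed `stub_asympCS`), (ARP), the translation half of E1 and a k-uniform
E0′ bound (closed form of `trunc_pair_le`). [folklore] -/
theorem stub_uclOfCsclPartA :
    ∀ (G : Type) [Group G] [TopologicalSpace G] [IsTopologicalGroup G] [CompactSpace G] [MeasurableSpace G] [BorelSpace G] (r : LatticeRep G) (sch : SpeciesScheme (YMSpecies G)), (∀ (A B B' D : ℕ → ℂ), (∃ C : ℝ, ∀ᶠ k in atTop, ‖A k‖ ≤ C ∧ ‖B k‖ ≤ C ∧ ‖B' k‖ ≤ C ∧ ‖D k‖ ≤ C) → (∀ (μ : ℂ) (ε : ℝ), 0 < ε → ∀ᶠ k in atTop, -ε ≤ (A k + μ * B k + (starRingEnd ℂ) μ * B' k + (starRingEnd ℂ) μ * μ * D k).re ∧ |(A k + μ * B k + (starRingEnd ℂ) μ * B' k + (starRingEnd ℂ) μ * μ * D k).im| ≤ ε) → ∀ η : ℝ, 0 < η → ∀ᶠ k in atTop, ‖B k‖ ≤ Real.sqrt ‖A k‖ * Real.sqrt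 ‖D k‖ + η) → Summit.QuantumFields.YangMills.Cruxes.ContinuumLimitOnTrajectory.TwoOrbitSynchronisation.ARP r sch → Summit.QuantumFields.YangMills.Cruxes.ContinuumLimitOnTrajectory.TwoOrbitSynchronisation.AsympTransl r sch → ∀ (K : ℕ → ℝ) (s : ℕ), (∀ p, 0 ≤ K p) → (∀ᶠ k in atTop, ∀ (p : ℕ) (F : SchwartzMap (Fin p → EuclideanSpace ℝ (Fin 4)) ℂ), IsOffDiagonal F → ‖Summit.QuantumFields.YangMills.Cruxes.ContinuumLimitOnTrajectory.TwoOrbitSynchronisation.curvDistribution r sch k p F‖ ≤ K p * schwartzNorm (p * s) F) → ∀ (n m : ℕ) (Φ : SchwartzMap (Fin n → EuclideanSpace ℝ (Fin 4)) ℂ) (Ψ : SchwartzMap (Fin m → EuclideanSpace ℝ (Fin 4)) ℂ), IsTimeOrdered Φ → IsTimeOrdered Ψ → ∀ (v : EuclideanSpace ℝ (Fin 4)), v 0 = 0 → ∀ (η : ℝ), 0 < η → ∀ᶠ k in atTop, ‖Summit.QuantumFields.YangMills.Cruxes.ContinuumLimitOnTrajectory.TwoOrbitSynchronisation.curvDistribution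 r sch k (n + m) ((osAdjoint Φ).appendTensor (translateMulti v Ψ)) - Summit.QuantumFields.YangMills.Cruxes.ContinuumLimitOnTrajectory.TwoOrbitSynchronisation.curvDistribution r sch k n (osAdjoint Φ) * Summit.QuantumFields.YangMills.Cruxes.ContinuumLimitOnTrajectory.TwoOrbitSynchronisation.curvDistribution r sch k m Ψ‖ ≤ Real.sqrt (K (n + n) * schwartzNorm ((n + n) * s) ((osAdjoint Φ).appendTensor Φ)) * Real.sqrt (K (m + m) * schwartzNorm ((m + m) * s) ((osAdjoint Ψ).appendTensor Ψ) + η) + η + K n * schwartzNorm (n * s) (osAdjoint Φ) * (K m * schwartzNorm (m * s) Ψ) :=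
  fun _ _ _ _ _ _ _ r sch hA hARP hTr _ _ hK hb _ _ _ _ hΦ hΨ _ hv _ hη =>
    trunc_pair_le r sch hA hARP hTr hK hb hΦ hΨ hv hη

end Summit.QuantumFields.YangMills.Theorems.ContinuumLegGivenGap

end
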